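import Summits.RiemannHypothesis.RiemannHypothesis.Theorems.TiltedLandingLaw421R3RateBooksQ3

/-! # TiltedLandingLaw421R3GapMeter — W-08 RATE^B: §B.11 the GAP METER through the DEFICIT door (director (CA375)(R2), C2 g37/g38 POSITION reading)
PRE-IMAGE: imports `…R3RateBooksQ3` (= C4 g28 LANDING LIST piece (2), §B.7 `classLawQ_of_deficitLaw`); checked as `scratch-gap` (pieces (1)+(2) bodies + this body).
`lowestReQ`, `gapLeftQ` / `gapRightQ` (last / first real zero of `f⁽ᵏ⁾` on either side of the lowest state's abscissa inside the `2R`-window), `gapWidthQ`,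
`gapMeterQ κ := gapWidth/(κ·s)`, `nonnegMeterQ_gapMeter` (K), `GapDeficitLawQ κ aD` (T, OPEN — ONE number per legal frame), `approachAllowanceQ_of_gapDeficit` (K),
`purseOfQ_gapMeter_le` (K: purse ≤ 4R/(κ s)), `restRateBotQ_of_gapDeficit` (K node); §B.11b the SELF-FUNDED instance
`GapSelfFundedLawQ κ c` (T, OPEN: deficits ≤ c·Φ_gap(0)), `approachAllowanceQ_of_gapSelfFunded`, `restRateBotQ_of_gapSelfFunded` (K; capital `aF + aC + (1+c)·Φ_gap(0)`).
Typed ≠ proved: the gap deficit law is a HYPOTHESIS measured by the engines (C6 g27 / C2 g38: κ′ and worst prefix); nothing here bears on the truth of RH;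
RH is NOT proved; 24774 OPEN. -/

namespace RhW08.SealSwapQ

open Complex
open RhIdea6.G17.W07C7 RhIdea6.G17.W07C7.Rev6 RhIdea6.G18.W07C8.Law421BirthS RhIdea6.G19.W07C11.Seam
open RhIdea6.G20.W07C12.Frac RhIdea6.G20.W07C12.StColP RhW07.C12.FieldSplit RhIdea6.G21.W07C13.TentMax
open RhW07.C14.TwoSided RhW07.C14.Classes RhW07.C14.Lineage RhW07.C14.Booking
open RhW07.C13.Heredity RhIdea6.G22.W07C15pre.Injection RhW07.E3.Cell
open RhW07.E3.Lit
open RhW08.Round1 RhW08.StSwap RhW08.Round2 RhW08.QuadW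
open RhW08.SealSwap (PBot)

/-! ## §B.11 (CA375)(R2) THE GAP METER (C2 g37/g38 POSITION reading «void invaded from both flanks»; director: Φ_gap(k) := (width of the real-zero-free
interval of f⁽ᵏ⁾ containing Re(lowest state))/s, entered through the §B.7 DEFICIT door with ONE measurable number). Typed, not proved: the law is (T, OPEN). -/

open Classical in
/-- §B.11 the abscissa of a lowest band state of level `k` (some `IsLowest` state; `x₀` if the level has no state). -/
noncomputable def lowestReQ (η : ℝ) (f : ℂ → ℂ) (x₀ s hmax R Hs : ℝ) (B k : ℕ) : ℝ :=
  if h : ∃ v : ℂ, IsLowest StTrkDQ η f x₀ s hmax R Hs B k v then (Classical.choose h).re else x₀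

/-- §B.11 the LEFT end of the real-zero-free gap of `f⁽ᵏ⁾` at the lowest state: the last real zero of `f⁽ᵏ⁾` at or left of `lowestReQ k`, floored at
`lowestReQ k − 2R` (so the gap is read inside the `2R`-window; `sSup` of a non-empty set bounded above by `lowestReQ k`). -/
noncomputable def gapLeftQ (η : ℝ) (f : ℂ → ℂ) (x₀ s hmax R Hs : ℝ) (B k : ℕ) : ℝ :=
  sSup ({t : ℝ | iteratedDeriv k f (t : ℂ) = 0 ∧ lowestReQ η f x₀ s hmax R Hs B k - 2 * R ≤ t ∧ t ≤ lowestReQ η f x₀ s hmax R Hs B k}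
    ∪ {lowestReQ η f x₀ s hmax R Hs B k - 2 * R})

/-- §B.11 the RIGHT end of the gap: the first real zero of `f⁽ᵏ⁾` at or right of `lowestReQ k`, capped at `lowestReQ k + 2R`. -/
noncomputable def gapRightQ (η : ℝ) (f : ℂ → ℂ) (x₀ s hmax R Hs : ℝ) (B k : ℕ) : ℝ :=
  sInf ({t : ℝ | iteratedDeriv k f (t : ℂ) = 0 ∧ lowestReQ η f x₀ s hmax R Hs B k ≤ t ∧ t ≤ lowestReQ η f x₀ s hmax R Hs B k + 2 * R}
    ∪ {lowestReQ η f x₀ s hmax R Hs B k + 2 * R})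

/-- §B.11 the GAP WIDTH at level `k` (non-negative part; `≤ 4R` by the window). -/
noncomputable def gapWidthQ (η : ℝ) (f : ℂ → ℂ) (x₀ s hmax R Hs : ℝ) (B k : ℕ) : ℝ :=
  max (gapRightQ η f x₀ s hmax R Hs B k - gapLeftQ η f x₀ s hmax R Hs B k) 0

/-- §B.11 **THE GAP METER** `Φ_gap(k) := gapWidth_k/(κ·s)` — `κ` = C6/C2's measured minimal shrink (in units of `s`) per net-charged approach unit. -/
noncomputable def gapMeterQ (κ : ℝ) : LevelMeter := fun η f x₀ s hmax R Hs B k =>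
  gapWidthQ η f x₀ s hmax R Hs B k / (κ * s)

/-- (K) §B.11 the gap meter is non-negative on legal data (`0 < s`, `0 < κ`). -/
theorem nonnegMeterQ_gapMeter {κ : ℝ} (hκ : 0 < κ) : NonnegMeterQ (gapMeterQ κ) := by
  intro η f x₀ s hmax R Hs B hE k
  have hs : 0 < s := hE.2.2.2.1
  unfold gapMeterQ gapWidthQ
  exact div_nonneg (le_max_right _ _) (mul_pos hκ hs).le

/-- (T, OPEN) §B.11 **THE GAP DEFICIT LAW**: the accumulated deficits of `Φ_gap` on APPROACH levels (levels where the gap shrinks by less than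
`κ·s·(1 − 4·drop/s)`, booked at their shortfall) stay within `aD` — ONE number per legal frame: `prefixSumQ (deficitQ (gapMeterQ κ) ApproachLevelQ)` at the
last charged level (ASK C6 g27 / C2 g38: κ′ and the worst prefix on N3 + replicas + banks, director (CA375)(R2)). -/
def GapDeficitLawQ (κ : ℝ) (aD : Budget) : Prop := DeficitLawQ (gapMeterQ κ) ApproachLevelQ aD

/-- ★★ (K) §B.11 **THE GAP METER PAYS (P4)** through the deficit door: `GapDeficitLawQ κ aD → ApproachAllowanceQ (Φ_gap(0) + aD)`. -/
theorem approachAllowanceQ_of_gapDeficit {κ : ℝ} {aD : Budget} (hκ : 0 < κ) (h : GapDeficitLawQ κ aD) :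
    ApproachAllowanceQ (addBudget (purseOfQ (gapMeterQ κ)) aD) :=
  classLawQ_of_deficitLaw (gapMeterQ κ) (nonnegMeterQ_gapMeter hκ) h

/-- (K) §B.11 the gap purse is at most `4R/(κ·s)` (the `2R`-window on each side), given `0 ≤ R`. -/
theorem purseOfQ_gapMeter_le {κ : ℝ} (hκ : 0 < κ) {η : ℝ} {f : ℂ → ℂ} {x₀ s hmax R Hs : ℝ} {B : ℕ} (hs : 0 < s) (hR : 0 ≤ R) :
    purseOfQ (gapMeterQ κ) η f x₀ s hmax R Hs B ≤ 4 * R / (κ * s) := by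
  unfold purseOfQ gapMeterQ gapWidthQ
  apply div_le_div_of_nonneg_right _ (mul_pos hκ hs).le
  apply max_le _ (by positivity)
  have hL : lowestReQ η f x₀ s hmax R Hs B 0 - 2 * R ≤ gapLeftQ η f x₀ s hmax R Hs B 0 := by
    unfold gapLeftQ
    apply le_csSup
    · refine ⟨lowestReQ η f x₀ s hmax R Hs B 0, ?_⟩
      rintro t (⟨-, -, ht⟩ | ht)
      · exact ht
      · rw [Set.mem_singleton_iff] at ht; rw [ht]; linarith
    · exact Or.inr rfl
  have hRt : gapRightQ η f x₀ s hmax R Hs B 0 ≤ lowestReQ η f x₀ s hmax R Hs B 0 + 2 * R := by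
    unfold gapRightQ
    apply csInf_le
    · refine ⟨lowestReQ η f x₀ s hmax R Hs B 0, ?_⟩
      rintro t (⟨-, ht, -⟩ | ht)
      · exact ht
      · rw [Set.mem_singleton_iff] at ht; rw [ht]; linarith
    · exact Or.inr rfl
  linarith

/-- ★★★ (K) §B.11 **THE GAP-FUNDED NODE**: far law + consumption law + the gap deficit law + capital for `aF + aC + (Φ_gap(0) + aD)` ⟹ `RestRateBotQ`. -/
theorem restRateBotQ_of_gapDeficit {κ : ℝ} {aF aC aD : Budget} (hF : FarLawQ aF) (hC : ConsLawQ aC) (hκ : 0 < κ)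
    (hG : GapDeficitLawQ κ aD) (hcap : CapitalLawQ aF aC (addBudget (purseOfQ (gapMeterQ κ)) aD)) : RestRateBotQ :=
  restRateBotQ_of_CA364 hF hC (approachAllowanceQ_of_gapDeficit hκ hG) hcap

/-! ## §B.11b the SELF-FUNDED instance (C6 RIDER-129: D(κ′) ≈ c·Φ_gap(0), c ≈ 0.4–0.6 on N3 / lateinj): deficits allowed up to `c·Φ_gap(0)` -/

/-- §B.11b a budget scaled by a constant (local twin-free name). -/
def scaleBudgetGapQ (t : ℝ) (a : Budget) : Budget := fun η f x₀ s hmax R Hs B => t * a η f x₀ s hmax R Hs B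

/-- (T, OPEN) §B.11b **SELF-FUNDED GAP LAW**: the accumulated gap deficits on approach levels stay within `c·Φ_gap(0)` (ONE pair (κ, c) for all legal frames). -/
def GapSelfFundedLawQ (κ c : ℝ) : Prop := GapDeficitLawQ κ (scaleBudgetGapQ c (purseOfQ (gapMeterQ κ)))

/-- (K) §B.11b purse + c·purse = (1 + c)·purse. -/
theorem addBudget_purse_scale (κ c : ℝ) :
    addBudget (purseOfQ (gapMeterQ κ)) (scaleBudgetGapQ c (purseOfQ (gapMeterQ κ)))
      = scaleBudgetGapQ (1 + c) (purseOfQ (gapMeterQ κ)) := by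
  funext η f x₀ s hmax R Hs B
  simp only [addBudget, scaleBudgetGapQ]
  ring

/-- ★★ (K) §B.11b the self-funded gap law pays (P4) with allowance `(1 + c)·Φ_gap(0)` (≤ `(1 + c)·4R/(κ s)`). -/
theorem approachAllowanceQ_of_gapSelfFunded {κ c : ℝ} (hκ : 0 < κ) (h : GapSelfFundedLawQ κ c) :
    ApproachAllowanceQ (scaleBudgetGapQ (1 + c) (purseOfQ (gapMeterQ κ))) := by
  rw [← addBudget_purse_scale]
  exact approachAllowanceQ_of_gapDeficit hκ h

/-- ★★★ (K) §B.11b **THE SELF-FUNDED GAP NODE**: far law + consumption law + `GapSelfFundedLawQ κ c` + capital `aF + aC + (1 + c)·Φ_gap(0)` ⟹ `RestRateBotQ`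
(C6 RIDER-129 first table: closes on all 11 replicas for κ ∈ [1, 2]; c to be fitted). -/
theorem restRateBotQ_of_gapSelfFunded {κ c : ℝ} {aF aC : Budget} (hF : FarLawQ aF) (hC : ConsLawQ aC) (hκ : 0 < κ)
    (hG : GapSelfFundedLawQ κ c) (hcap : CapitalLawQ aF aC (scaleBudgetGapQ (1 + c) (purseOfQ (gapMeterQ κ)))) : RestRateBotQ :=
  restRateBotQ_of_CA364 hF hC (approachAllowanceQ_of_gapSelfFunded hκ hG) hcap

end RhW08.SealSwapQ
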